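import Summits.CriticalPhenomena.PercolationContinuityZ3.Theorems.Transplant.FKConnectivityAllQAntipodalLevel4
import Literature.Probability.LatticeModels.RandomClusterEmbedding
import HarnessLib

/-!
# Connectivity correlation inequalities for `φ_{w,q}`, every `q > 0` — file 41: the antipodal functionals and two-terminal
# series–parallel networks ALONG AN EMBEDDING OF VERTEX TYPES

Support file (`--supports stmt-CriticalPhenomena-4575`), FK sub-lane `prim-bschramm-fk-2` (gen 20); builds on p205010 (kernel theorem,
internal audit signed; external expert review pending).  No definitions, no named facts, no sorries; standard axioms.

The gadget argument for contraction cells (memo `bschramm/FROM-fk-2-g20-LEVEL3-ONESUM.md` §6.2) needs arbitrarily many fresh vertices,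
hence hosts transported along `j : V ↪ U` (`Finset.map j.sym2Map`).  Idle vertices of `U` are isolated clusters in both members of a
complementary pair, so:
* `FK.apExpC_map` — `apExpC (j M) (j C) (j γ) = apExpC M C γ + 2·#idle` (`Literature…RandomClusterEmbedding.clusterCount_map_image`);
* `FK.sum_powerset_map` — re-indexing sums over configurations along `j`;
* **`FK.apPsiC_map`** — `apPsiC q (j M) (j C) f' g' = q^{2·#idle} · apPsiC q M C f g` whenever `f' (j X) = f X`, `g' (j X) = g X`;
* **`FK.IsTTSP.map`** — `E` TTSP between `s, t` ⟹ `j E` TTSP between `j s, j t`;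
* pull-backs of test functions (`FK.pull_map`, `FK.pull_insert_map`, `FK.pull_insert_of_notMem_range`, `FK.pull_mono`): for
  `g` on `V`-configurations, `X' ↦ g {e | j e ∈ X'}` is the test function on `U` that agrees with `g` on images, is monotone, and reads neither
  the images of unread pairs nor the pairs off the range.
[cite: Grimmett2006, §1.2 eq. (1.1) (p. 4); §1.4 eq. (1.20) (p. 15); Lemma (4.13) (p. 71)]
-/

noncomputable section

namespace Summit.CriticalPhenomena.PercolationContinuityZ3.Theorems

namespace FK

open Literature.Probability.LatticeModels Literature.Probability.Percolation
open scoped Classical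

variable {V U : Type*} (j : V ↪ U)

/-! ### Set algebra along the embedding -/

section SetAlgebra

/-- Images of differences along an embedding of pairs. [folklore] -/
theorem map_sdiff_sym2Map (M γ : Finset (Sym2 V)) : (M \ γ).map j.sym2Map = M.map j.sym2Map \ γ.map j.sym2Map := by
  rw [Finset.map_eq_image, Finset.map_eq_image, Finset.map_eq_image]
  exact Finset.image_sdiff _ _ j.sym2Map.injective

/-- The pull-back of an image configuration is the configuration. [folklore] -/
theorem pull_map [Fintype V] (X : Finset (Sym2 V)) :
    (Finset.univ.filter fun e : Sym2 V => j.sym2Map e ∈ X.map j.sym2Map) = X := by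
  ext e
  simp only [Finset.mem_filter, Finset.mem_univ, true_and, Finset.mem_map' ]

/-- Pull-back of `insert (j x) X'` is `insert x` of the pull-back. [folklore] -/
theorem pull_insert_map [Fintype V] (x : Sym2 V) (X' : Finset (Sym2 U)) :
    (Finset.univ.filter fun e : Sym2 V => j.sym2Map e ∈ insert (j.sym2Map x) X') =
      insert x (Finset.univ.filter fun e : Sym2 V => j.sym2Map e ∈ X') := by
  ext e
  simp only [Finset.mem_filter, Finset.mem_univ, true_and, Finset.mem_insert, j.sym2Map.injective.eq_iff]

/-- Pull-back ignores pairs off the range of `j`. [folklore] -/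
theorem pull_insert_of_notMem_range [Fintype V] {e' : Sym2 U} (he' : e' ∉ Set.range j.sym2Map) (X' : Finset (Sym2 U)) :
    (Finset.univ.filter fun e : Sym2 V => j.sym2Map e ∈ insert e' X') =
      (Finset.univ.filter fun e : Sym2 V => j.sym2Map e ∈ X') := by
  ext e
  simp only [Finset.mem_filter, Finset.mem_univ, true_and, Finset.mem_insert]
  constructor
  · rintro (h | h)
    · exact absurd ⟨e, h⟩ he'
    · exact h
  · exact fun h => Or.inr h

/-- Pull-back is monotone. [folklore] -/
theorem pull_mono [Fintype V] {X' Y' : Finset (Sym2 U)} (h : X' ⊆ Y') :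
    (Finset.univ.filter fun e : Sym2 V => j.sym2Map e ∈ X') ⊆ (Finset.univ.filter fun e : Sym2 V => j.sym2Map e ∈ Y') := by
  intro e he
  simp only [Finset.mem_filter, Finset.mem_univ, true_and] at he ⊢
  exact h he

/-- Pull-back of a sub-configuration of an image is a sub-configuration. [folklore] -/
theorem pull_subset_of_subset_map [Fintype V] {X' : Finset (Sym2 U)} {Y : Finset (Sym2 V)} (h : X' ⊆ Y.map j.sym2Map) :
    (Finset.univ.filter fun e : Sym2 V => j.sym2Map e ∈ X') ⊆ Y := by
  intro e he
  simp only [Finset.mem_filter, Finset.mem_univ, true_and] at he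
  exact (Finset.mem_map' _).1 (h he)

/-- A pair containing a vertex off the range of `j` is off the range of `j.sym2Map`. [folklore] -/
theorem notMem_range_sym2Map_of_mem {e' : Sym2 U} {x : U} (hx : x ∉ Set.range j) (hxe : x ∈ e') : e' ∉ Set.range j.sym2Map := by
  rintro ⟨e, rfl⟩
  rw [Function.Embedding.sym2Map_apply, Sym2.mem_map] at hxe
  obtain ⟨w, _, hw⟩ := hxe
  exact hx ⟨w, hw⟩

end SetAlgebra

/-! ### The antipodal functionals along the embedding -/

section Functionals

variable [Fintype U]

/-- **The antipodal exponent with contracted set along an embedding**: the idle vertices add `2·#idle`.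
[cite: Grimmett2006, §1.2 eq. (1.1) (p. 4); §1.4 eq. (1.20) (p. 15)] -/
theorem apExpC_map (M C γ : Finset (Sym2 V)) :
    apExpC (M.map j.sym2Map) (C.map j.sym2Map) (γ.map j.sym2Map) = apExpC M C γ + 2 * Nat.card {u : U // u ∉ Set.range j} := by
  unfold apExpC
  have h1 := clusterCount_map_image j (γ ∪ C) ∅
  have h2 := clusterCount_map_image j (M \ γ ∪ C) ∅
  rw [Set.image_empty] at h1 h2
  rw [← map_sdiff_sym2Map, ← Finset.map_union, ← Finset.map_union, h1, h2]
  ring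

omit [Fintype U] in
/-- Re-indexing a sum over the configurations of `j M` by the configurations of `M`. [folklore] -/
theorem sum_powerset_map {β : Type*} [AddCommMonoid β] (M : Finset (Sym2 V)) (F : Finset (Sym2 U) → β) :
    ∑ ω ∈ M.powerset, F (ω.map j.sym2Map) = ∑ ω' ∈ (M.map j.sym2Map).powerset, F ω' := by
  refine Finset.sum_nbij (fun ω => ω.map j.sym2Map) (fun ω hω => ?_)
    (fun ω₁ _ ω₂ _ h => Finset.map_injective _ h) (fun ω' hω' => ?_) (fun _ _ => rfl)
  · rw [Finset.mem_powerset] at hω ⊢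
    exact Finset.map_subset_map.2 hω
  · rw [Finset.mem_coe, Finset.mem_powerset, Finset.subset_map_iff] at hω'
    obtain ⟨ω, hω, rfl⟩ := hω'
    exact ⟨ω, by rw [Finset.mem_coe, Finset.mem_powerset]; exact hω, rfl⟩

/-- **The antipodal covariance form with contracted set along an embedding**: if `f', g'` agree with `f, g` on images, then
`apPsiC q (j M) (j C) f' g' = q^{2·#idle} · apPsiC q M C f g`. [cite: Grimmett2006, §1.4 eq. (1.20) (p. 15); Lemma (4.13) (p. 71)] -/
theorem apPsiC_map (q : ℝ) (M C : Finset (Sym2 V)) {f g : Finset (Sym2 V) → ℝ} {f' g' : Finset (Sym2 U) → ℝ}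
    (hf : ∀ X : Finset (Sym2 V), f' (X.map j.sym2Map) = f X) (hg : ∀ X : Finset (Sym2 V), g' (X.map j.sym2Map) = g X) :
    apPsiC q (M.map j.sym2Map) (C.map j.sym2Map) f' g' = q ^ (2 * Nat.card {u : U // u ∉ Set.range j}) * apPsiC q M C f g := by
  unfold apPsiC
  rw [Finset.mul_sum, ← sum_powerset_map]
  refine Finset.sum_congr rfl fun γ _ => ?_
  rw [← map_sdiff_sym2Map, ← Finset.map_union, ← Finset.map_union, hf, hf, hg, hg, apExpC_map, pow_add]
  ring

end Functionals

/-! ### Two-terminal series–parallel networks along the embedding -/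

section TTSP

omit j in
/-- Membership of a vertex in an image pair. [folklore] -/
theorem mem_sym2Map_iff (j : V ↪ U) {e : Sym2 V} {z : U} : z ∈ j.sym2Map e ↔ ∃ w ∈ e, j w = z := by
  rw [Function.Embedding.sym2Map_apply, Sym2.mem_map]

/-- **Two-terminal series–parallel networks are preserved by an embedding of vertex types.** [folklore] -/
theorem IsTTSP.map {E : Finset (Sym2 V)} {s t : V} (hE : IsTTSP E s t) : IsTTSP (E.map j.sym2Map) (j s) (j t) := by
  induction hE with
  | @edge s t hst =>
    rw [Finset.map_singleton, Function.Embedding.sym2Map_apply, Sym2.map_mk]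
    exact IsTTSP.edge (j.injective.ne hst)
  | @series E₁ E₂ a m b h₁ h₂ hd hV ha hb ih₁ ih₂ =>
    rw [Finset.map_union]
    refine IsTTSP.series ih₁ ih₂ ((Finset.disjoint_map _).2 hd) (fun z hz₁ hz₂ => ?_) (fun e he => ?_) (fun e he => ?_)
    · obtain ⟨e₁, he₁, hz₁⟩ := hz₁
      obtain ⟨e₂, he₂, hz₂⟩ := hz₂
      rw [Finset.mem_map] at he₁ he₂
      obtain ⟨f₁, hf₁, rfl⟩ := he₁
      obtain ⟨f₂, hf₂, rfl⟩ := he₂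
      obtain ⟨w₁, hw₁, rfl⟩ := (mem_sym2Map_iff j).1 hz₁
      obtain ⟨w₂, hw₂, hw⟩ := (mem_sym2Map_iff j).1 hz₂
      have hww : w₂ = w₁ := j.injective hw
      subst hww
      rw [hV w₂ ⟨f₁, hf₁, hw₁⟩ ⟨f₂, hf₂, hw₂⟩]
    · rw [Finset.mem_map] at he
      obtain ⟨f₂, hf₂, rfl⟩ := he
      intro hmem
      obtain ⟨w, hw, hwj⟩ := (mem_sym2Map_iff j).1 hmem
      rw [j.injective hwj] at hw
      exact ha f₂ hf₂ hw
    · rw [Finset.mem_map] at he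
      obtain ⟨f₁, hf₁, rfl⟩ := he
      intro hmem
      obtain ⟨w, hw, hwj⟩ := (mem_sym2Map_iff j).1 hmem
      rw [j.injective hwj] at hw
      exact hb f₁ hf₁ hw
  | @parallel E₁ E₂ s t h₁ h₂ hd hV ih₁ ih₂ =>
    rw [Finset.map_union]
    refine IsTTSP.parallel ih₁ ih₂ ((Finset.disjoint_map _).2 hd) (fun z hz₁ hz₂ => ?_)
    obtain ⟨e₁, he₁, hz₁⟩ := hz₁
    obtain ⟨e₂, he₂, hz₂⟩ := hz₂
    rw [Finset.mem_map] at he₁ he₂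
    obtain ⟨f₁, hf₁, rfl⟩ := he₁
    obtain ⟨f₂, hf₂, rfl⟩ := he₂
    obtain ⟨w₁, hw₁, rfl⟩ := (mem_sym2Map_iff j).1 hz₁
    obtain ⟨w₂, hw₂, hw⟩ := (mem_sym2Map_iff j).1 hz₂
    have hww : w₂ = w₁ := j.injective hw
    subst hww
    rcases hV w₂ ⟨f₁, hf₁, hw₁⟩ ⟨f₂, hf₂, hw₂⟩ with h | h
    · exact Or.inl (by rw [h])
    · exact Or.inr (by rw [h])

end TTSP

end FK

end Summit.CriticalPhenomena.PercolationContinuityZ3.Theorems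

end
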